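import Summits.RiemannHypothesis.RiemannHypothesis.Theorems.Splittings.SplitXWucStarRowD
import Summits.RiemannHypothesis.RiemannHypothesis.Theses.XWucRLadder
import HarnessLib

/-!
# Route XWucRLadder (L9 «X-WUC R-LADDER») — `StarRowExp1024` (item stmt-RiemannHypothesis-23478) BY NAME

The support item ★₁₀₂₄ʳ `HSW → K1′(all continuous complex f; Lc = 400, δ = 3/2, θ = 21/500) → (RH ⟺ RH(e^1024) ∧ B′₁([−1,1]))`
is the tree theorem `XWucG8.rh_iff_rhUpTo_exp1024_and_boundedAwayAt_of_kCertLR` (part D of the ★-row port) at `θ = 21/500`: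
the item states K1′ with the TREE `KCertRefutation.tfT` / `KCertRefutation.Phi` and concludes with the TREE
`BombieriTruncMassAware.TruncNegEigenvalueBoundedAwayAt`; the port's `KCertLR` body (`XWucG8.tfT` / `XWucG8.Phi`) agrees with
the former up to delta and its conclusion IS the latter, so the closer is a three-line term.  Filed by rh-split-typer-5 under
lead g9 RULINGS #359/#365, `--workitem stmt-RiemannHypothesis-23478`.  CONDITIONAL bookkeeping: K-CERT′ (complex f) is an
OPEN cell node and HSW a print fact in hypothesis position; the residuals RH(e^1024), B′₁ are never staffed; RH is not
proved by this; nothing here bears on the truth of RH.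
-/

-- D-0017: `Summit.RiemannHypothesis.RiemannHypothesis.…` duplicates the namespace BY DESIGN (single-problem summit).
set_option linter.dupNamespace false

namespace Summit.RiemannHypothesis.RiemannHypothesis.Theorems.Splittings.XWucG8

/-- **`StarRowExp1024` (item stmt-RiemannHypothesis-23478) holds** — by `rh_iff_rhUpTo_exp1024_and_boundedAwayAt_of_kCertLR`
at `θ = 21/500` (`0.042 ≤ 21/500` by `norm_num`); the item's K1′ hypothesis is `KCertLR 400 (3/2) (21/500)` up to delta. -/
theorem starRowExp1024_proof :
    Summit.RiemannHypothesis.RiemannHypothesis.Theses.XWucRLadder.StarRowExp1024 := by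
  intro hHSW hK
  exact rh_iff_rhUpTo_exp1024_and_boundedAwayAt_of_kCertLR (θ := 21 / 500) (by norm_num) hK hHSW

end Summit.RiemannHypothesis.RiemannHypothesis.Theorems.Splittings.XWucG8
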